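import Literature.Computability.QuantumComplexity.AlgebraicForrelationFooling
import Literature.Computability.QuantumComplexity.RazTalMaskedUniform
import Literature.Computability.QuantumComplexity.OracleSeparationBQPPHProofs
import HarnessLib

/-!
# The algebraic oracle separation `BQP^A ⊄ BPP^Ã` (Aaronson–Wigderson, Thm. 5.11 (v)): the diagonalization

Topic `Literature/Computability/QuantumComplexity`. Assembly of the algebraic oracle separation of
Aaronson–Wigderson, *Algebrization: a new barrier in complexity theory* (STOC 2008, full version),
Thm. 5.11 (v) — "there exist `A, Ã` such that `BQP^A ⊄ BPP^Ã` … furthermore `Ã` is simply the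
multilinear extension of `A`" — in the tree's models (`BQPRel`: uniform Clifford+T families with
XOR query gates; `BPPRel O = bp (P^O)` in the transcript model; `multilinearExtension A` over the
prime fields), from

* the uniform `BQP^A` machine running Raz–Tal's `Q₁` on the **XOR-masked** level-`n` window
  `x_n = R_n ⊕ Y_n` of the oracle (`razTalMasked_bqpMachine`, files `RazTalMasked*.lean`), and
* the classical side proved in `AlgebraicForrelationFooling.lean` (`ext_gap_small`: no `BPP`
  machine querying `Ã` tells `x_n ∼ 𝒟₁` from uniform through the masked layout; Aaronson–
  Wigderson's transfer principle Thm. 4.11, the Fourier growth of XOR-fibres, Raz–Tal Thm. 7.4)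
  together with Raz–Tal's Claim 8.1 (`razTal2022_claim81_holds`),

by the stage-wise diagonalization of Ko (1989, §3) exactly as in the tree's
`OracleSeparationBQPBPP.lean` (Bernstein–Vazirani 1997, Cor. 8.14; Raz–Tal App. A), with double
windows `(R_n, Y_n)` in place of windows:

* `mLangOf` (the oracle of an assignment of double windows), `mWindow_mLangOf`,
  `mPatchLevel_mLangOf`, `mLangOf_congr` (locality by length);
* the stages `mDiagSeq`, `mDiagW` and their freezing lemmas;
* the stage lemma `exists_defeating_dwindow` (if every double window kept the machine correct at
  `1ⁿ`, the mask-averaged acceptance probability `h` would be sandwiched by `q1Accept` and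
  `𝔼_{𝒟₁} h − 𝔼_U h > 1/10`, contradicting `ext_gap_small`);
* **`exists_oracle_BQPRel_not_subset_BPPRel_multilinearExtension`**: an oracle `A` with
  `BQP^A ⊄ BPP^{Ã}`, `Ã = multilinearExtension A` (no hypotheses). The named fact
  `Literature.Computability.Complexity.aaronsonWigderson2009_bqp_not_subset_bpp` is discharged from
  it in `Complexity/AlgebrizationBarriersBQPProofs.lean`.

## References

* S. Aaronson, A. Wigderson, *Algebrization: a new barrier in complexity theory*, STOC 2008 (full
  version), Thm. 5.11 (v) and proof sketch p. 28, Thm. 4.11, Def. 2.2–2.3 [AaronsonWigderson2008].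
* R. Raz, A. Tal, *Oracle separation of BQP and PH*, J. ACM 69 (2022), App. A, Claims 8.1–8.2
  [RazTalJACM2022].
* E. Bernstein, U. Vazirani, *Quantum complexity theory*, SIAM J. Comput. 26 (1997), §8.4,
  Cor. 8.14 [BernsteinVazirani1997].
* K.-I Ko, *Constructing oracles by lower bound techniques for circuits* (1989), §3 [Ko1989].
-/

noncomputable section

namespace Literature.Computability.QuantumComplexity

open _root_.Computability Complexity Cryptography Finset

/-! ### The oracle of an assignment of double windows -/

/-- An assignment of a double window `(R_n, Y_n)` to every level. [cite: AaronsonWigderson2008, Thm. 5.11 (v)] -/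
abbrev DWindows : Type := ∀ n, Window n × Window n

/-- **The oracle of an assignment of double windows**: the masked address `rtAddr n i k ++ [c]`
belongs to it iff bit `(i, k)` of `R_n` (`c = 0`) resp. `Y_n` (`c = 1`) is set; nothing else.
[cite: AaronsonWigderson2008, Thm. 5.11 (v)] -/
def mLangOf (DW : DWindows) : Language Bool :=
  {s | ∃ (n : ℕ) (p : Idx n × Bool), mAddrE n p = s ∧ (if p.2 then (DW n).2 p.1.1 p.1.2 else (DW n).1 p.1.1 p.1.2) = true}

/-- Membership of a masked address. [folklore] -/
theorem mAddrE_mem_mLangOf (DW : DWindows) (n : ℕ) (p : Idx n × Bool) :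
    mAddrE n p ∈ mLangOf DW ↔ (if p.2 then (DW n).2 p.1.1 p.1.2 else (DW n).1 p.1.1 p.1.2) = true := by
  constructor
  · rintro ⟨n', p', h, hw⟩
    by_cases hn : n' = n
    · subst hn
      rw [mAddrE_injective n' h] at hw
      exact hw
    · exact absurd h (mAddrE_ne_of_ne hn p' p)
  · intro hw
    exact ⟨n, p, rfl, hw⟩

/-- Reading a masked address bit through the indicator. [folklore] -/
theorem boolIndicator_mLangOf (DW : DWindows) (n : ℕ) (p : Idx n × Bool) :
    (mLangOf DW).boolIndicator (mAddrE n p) =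
      (if p.2 then (DW n).2 p.1.1 p.1.2 else (DW n).1 p.1.1 p.1.2) := by
  cases hb : (if p.2 then (DW n).2 p.1.1 p.1.2 else (DW n).1 p.1.1 p.1.2)
  · exact (Set.notMem_iff_boolIndicator _ _).1 (mt (mAddrE_mem_mLangOf DW n p).1 (by simp [hb]))
  · exact (Set.mem_iff_boolIndicator _ _).1 ((mAddrE_mem_mLangOf DW n p).2 hb)

/-- **The masked window of the oracle of an assignment is `R_n ⊕ Y_n`.** [cite: AaronsonWigderson2008, Thm. 5.11 (v)] -/
theorem mWindow_mLangOf (DW : DWindows) (n : ℕ) : mWindow (mLangOf DW) n = xorWin (DW n).1 (DW n).2 := by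
  funext i k
  have h0 := boolIndicator_mLangOf DW n ((i, k), false)
  have h1 := boolIndicator_mLangOf DW n ((i, k), true)
  simp only [mAddrE, Bool.false_eq_true, if_false, if_true] at h0 h1
  simp only [mWindow, xorWin, h0, h1]

/-- Patching level `n` of the oracle of an assignment is reassigning level `n`. [folklore] -/
theorem mPatchLevel_mLangOf (DW : DWindows) (n : ℕ) (RY : Window n × Window n) :
    mPatchLevel (mLangOf DW) n RY = mLangOf (Function.update DW n RY) := by
  ext s
  by_cases hs : ∃ p : Idx n × Bool, mAddrE n p = s
  · obtain ⟨p, rfl⟩ := hs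
    have h1 := mem_dwPatch_of_eq (A₀ := mLangOf DW) (mAddrE_injective n) (fun p : Idx n => RY.1 p.1 p.2)
      (fun p : Idx n => RY.2 p.1 p.2) p.1 p.2
    change mAddrE n p ∈ mPatchLevel (mLangOf DW) n RY ↔ mAddrE n p ∈ mLangOf (Function.update DW n RY)
    rw [mAddrE_mem_mLangOf, Function.update_self]
    rw [show mAddrE n p = mAddrE n (p.1, p.2) from rfl] at *
    rw [show mPatchLevel (mLangOf DW) n RY = dwPatch (mLangOf DW) (mAddrE n) (fun p : Idx n => RY.1 p.1 p.2)
      (fun p : Idx n => RY.2 p.1 p.2) from rfl, h1]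
  · push Not at hs
    have h1 := mem_dwPatch_of_not_mem_range (A₀ := mLangOf DW) (e := mAddrE n) (fun p : Idx n => RY.1 p.1 p.2)
      (fun p : Idx n => RY.2 p.1 p.2) hs
    change s ∈ mPatchLevel (mLangOf DW) n RY ↔ s ∈ mLangOf (Function.update DW n RY)
    rw [show (s ∈ mPatchLevel (mLangOf DW) n RY) ↔ s ∈ mLangOf DW from h1]
    constructor
    · rintro ⟨n', p', h, hw⟩
      have hn : n' ≠ n := by rintro rfl; exact hs p' h
      exact ⟨n', p', h, by rw [Function.update_of_ne hn]; exact hw⟩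
    · rintro ⟨n', p', h, hw⟩
      have hn : n' ≠ n := by rintro rfl; exact hs p' h
      rw [Function.update_of_ne hn] at hw
      exact ⟨n', p', h, hw⟩

/-- **Locality by length**: membership of a string of length `≤ B` in the oracle of an assignment
depends only on the double windows of the levels `m < B` (a masked address of level `m` has length
`ℓ(m) + 1 > m`). [folklore] -/
theorem mLangOf_congr {DW DW' : DWindows} {B : ℕ} (h : ∀ m, m < B → DW m = DW' m)
    (s : List Bool) (hs : s.length ≤ B) : s ∈ mLangOf DW ↔ s ∈ mLangOf DW' := by
  have key : ∀ (m : ℕ) (p : Idx m × Bool), mAddrE m p = s → DW m = DW' m := by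
    intro m p hm
    apply h
    have hl := congrArg List.length hm
    rw [length_mAddrE] at hl
    have := le_rtLen m
    omega
  constructor
  · rintro ⟨m, p, hm, hw⟩
    exact ⟨m, p, hm, by rw [← key m p hm]; exact hw⟩
  · rintro ⟨m, p, hm, hw⟩
    exact ⟨m, p, hm, by rw [key m p hm]; exact hw⟩

/-! ### The stages (Ko 1989, §3), for double windows -/

section Diag

/-- A state: the current assignment of double windows and the first free level. [cite: Ko1989, §3] -/
structure MDiagState where
  /-- The current assignment of a double window to every level. -/
  W : DWindows
  /-- Levels below `lvl` are frozen. -/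
  lvl : ℕ

variable (W₀ : DWindows) (N₀ : ℕ) (thr : PHDescr → ℕ)
  (pick : (D : PHDescr) → (n : ℕ) → Language Bool → (Window n × Window n) × Bool) (e : ℕ → PHDescr)

/-- **The stages**: stage `i` treats the description `e i` at the level
`n_i = max lvl (thr (e i))`, writes the defeating double window there and freezes every level the
description may have read at `1^{n_i}`. [cite: Ko1989, §3] [cite: RazTalJACM2022, App. A] -/
def mDiagSeq : ℕ → MDiagState
  | 0 => ⟨W₀, N₀⟩
  | i + 1 =>
    ⟨Function.update (mDiagSeq i).W (max (mDiagSeq i).lvl (thr (e i)))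
        (pick (e i) (max (mDiagSeq i).lvl (thr (e i))) (mLangOf (mDiagSeq i).W)).1,
      max (max (mDiagSeq i).lvl (thr (e i)) + 1)
        ((e i).reach (max (mDiagSeq i).lvl (thr (e i))) + 1)⟩

/-- The level treated at stage `i`. [cite: RazTalJACM2022, App. A] -/
def mStageLvl (i : ℕ) : ℕ := max (mDiagSeq W₀ N₀ thr pick e i).lvl (thr (e i))

/-- The double window and verdict chosen at stage `i`. [cite: RazTalJACM2022, App. A] -/
def mStagePick (i : ℕ) : (Window (mStageLvl W₀ N₀ thr pick e i) × Window (mStageLvl W₀ N₀ thr pick e i)) × Bool :=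
  pick (e i) (mStageLvl W₀ N₀ thr pick e i) (mLangOf (mDiagSeq W₀ N₀ thr pick e i).W)

/-- **The limit assignment.** [cite: RazTalJACM2022, App. A] -/
def mDiagW : DWindows := fun n => (mDiagSeq W₀ N₀ thr pick e (n + 1)).W n

/-- The assignment after stage `i`. [cite: Ko1989, §3] -/
theorem mDiagSeq_succ_W (i : ℕ) :
    (mDiagSeq W₀ N₀ thr pick e (i + 1)).W =
      Function.update (mDiagSeq W₀ N₀ thr pick e i).W (mStageLvl W₀ N₀ thr pick e i)
        (mStagePick W₀ N₀ thr pick e i).1 :=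
  rfl

/-- The frozen prefix after stage `i`. [cite: Ko1989, §3] -/
theorem mDiagSeq_succ_lvl (i : ℕ) :
    (mDiagSeq W₀ N₀ thr pick e (i + 1)).lvl =
      max (mStageLvl W₀ N₀ thr pick e i + 1) ((e i).reach (mStageLvl W₀ N₀ thr pick e i) + 1) :=
  rfl

/-- Stage `i` works at a free level. [cite: Ko1989, §3] -/
theorem lvl_le_mStageLvl (i : ℕ) : (mDiagSeq W₀ N₀ thr pick e i).lvl ≤ mStageLvl W₀ N₀ thr pick e i :=
  le_max_left _ _

/-- Stage `i` works at a level large enough for the stage lemma. [cite: Ko1989, §3] -/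
theorem thr_le_mStageLvl (i : ℕ) : thr (e i) ≤ mStageLvl W₀ N₀ thr pick e i :=
  le_max_right _ _

/-- The level of stage `i` is frozen afterwards. [cite: Ko1989, §3] -/
theorem mStageLvl_lt_lvl_succ (i : ℕ) :
    mStageLvl W₀ N₀ thr pick e i < (mDiagSeq W₀ N₀ thr pick e (i + 1)).lvl := by
  rw [mDiagSeq_succ_lvl]; omega

/-- Everything the `i`-th description read at its probe is frozen afterwards. [cite: Ko1989, §3] -/
theorem reach_lt_mlvl_succ (i : ℕ) :
    (e i).reach (mStageLvl W₀ N₀ thr pick e i) < (mDiagSeq W₀ N₀ thr pick e (i + 1)).lvl := by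
  rw [mDiagSeq_succ_lvl]; omega

/-- The frozen prefix grows by at least one level per stage. [folklore] -/
theorem add_le_mlvl (i : ℕ) : N₀ + i ≤ (mDiagSeq W₀ N₀ thr pick e i).lvl := by
  induction i with
  | zero => exact le_rfl
  | succ i ih =>
    have h1 := lvl_le_mStageLvl W₀ N₀ thr pick e i
    have h2 := mStageLvl_lt_lvl_succ W₀ N₀ thr pick e i
    omega

/-- The frozen prefix only grows. [cite: Ko1989, §3] -/
theorem mlvl_mono {i j : ℕ} (hij : i ≤ j) :
    (mDiagSeq W₀ N₀ thr pick e i).lvl ≤ (mDiagSeq W₀ N₀ thr pick e j).lvl := by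
  induction hij with
  | refl => exact le_rfl
  | step _ ih =>
    exact ih.trans ((lvl_le_mStageLvl W₀ N₀ thr pick e _).trans (mStageLvl_lt_lvl_succ W₀ N₀ thr pick e _).le)

/-- **Freezing**: a level below `lvl_i` keeps its double window at all later stages. [cite: RazTalJACM2022, App. A] -/
theorem mW_eq_of_lt_lvl {n i j : ℕ} (hn : n < (mDiagSeq W₀ N₀ thr pick e i).lvl) (hij : i ≤ j) :
    (mDiagSeq W₀ N₀ thr pick e j).W n = (mDiagSeq W₀ N₀ thr pick e i).W n := by
  induction hij with
  | refl => rfl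
  | @step j hij ih =>
    rw [mDiagSeq_succ_W, Function.update_of_ne, ih]
    have h1 := mlvl_mono W₀ N₀ thr pick e hij
    have h2 := lvl_le_mStageLvl W₀ N₀ thr pick e j
    omega

/-- The limit double window of a level frozen at stage `j` is its stage-`j` double window. [cite: RazTalJACM2022, App. A] -/
theorem mDiagW_eq_of_lt_lvl {n j : ℕ} (hn : n < (mDiagSeq W₀ N₀ thr pick e j).lvl) :
    mDiagW W₀ N₀ thr pick e n = (mDiagSeq W₀ N₀ thr pick e j).W n := by
  unfold mDiagW
  rcases le_total j (n + 1) with h | h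
  · exact mW_eq_of_lt_lvl W₀ N₀ thr pick e hn h
  · have hn' : n < (mDiagSeq W₀ N₀ thr pick e (n + 1)).lvl :=
      lt_of_lt_of_le (by omega) (add_le_mlvl W₀ N₀ thr pick e (n + 1))
    exact (mW_eq_of_lt_lvl W₀ N₀ thr pick e hn' h).symm

/-- The limit double window at a stage level is the one picked at that stage. [cite: RazTalJACM2022, App. A] -/
theorem mDiagW_mStageLvl (i : ℕ) :
    mDiagW W₀ N₀ thr pick e (mStageLvl W₀ N₀ thr pick e i) = (mStagePick W₀ N₀ thr pick e i).1 := by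
  rw [mDiagW_eq_of_lt_lvl W₀ N₀ thr pick e (mStageLvl_lt_lvl_succ W₀ N₀ thr pick e i), mDiagSeq_succ_W,
    Function.update_self]

/-- Every level carries either its default double window or the one of the stage that treated it. [folklore] -/
theorem mDiagW_eq_or (n : ℕ) :
    mDiagW W₀ N₀ thr pick e n = W₀ n ∨ ∃ i, mStageLvl W₀ N₀ thr pick e i = n := by
  suffices h : ∀ j, (mDiagSeq W₀ N₀ thr pick e j).W n = W₀ n ∨ ∃ i, mStageLvl W₀ N₀ thr pick e i = n from
    h (n + 1)
  intro j
  induction j with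
  | zero => exact Or.inl rfl
  | succ j ih =>
    by_cases hj : mStageLvl W₀ N₀ thr pick e j = n
    · exact Or.inr ⟨j, hj⟩
    · rw [mDiagSeq_succ_W, Function.update_of_ne (Ne.symm hj)]
      exact ih

/-- After stage `i` the oracle no longer changes below the reach of the `i`-th description at its
probe input. [cite: RazTalJACM2022, App. A] -/
theorem mem_mLangOf_mDiagW_iff (i : ℕ) (s : List Bool)
    (hs : s.length ≤ (e i).reach (mStageLvl W₀ N₀ thr pick e i)) :
    s ∈ mLangOf (mDiagW W₀ N₀ thr pick e) ↔ s ∈ mLangOf (mDiagSeq W₀ N₀ thr pick e (i + 1)).W := by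
  refine mLangOf_congr (fun m hm => ?_) s hs
  exact mDiagW_eq_of_lt_lvl W₀ N₀ thr pick e (hm.trans (reach_lt_mlvl_succ W₀ N₀ thr pick e i))

end Diag

/-! ### The stage lemma -/

/-- The reach of the description `⟨[p], M, q⟩` dominates the query bound at the paired probe. [folklore] -/
theorem extReach_le_reach (M : OracleAlg Bool) (q p : Polynomial ℕ) (n : ℕ) :
    extReach q p n ≤ PHDescr.reach ⟨[p], M, q⟩ n := by
  change q.eval (2 * n + 2 + p.eval n) ≤
    (Finset.range (p.eval n + 1)).sup fun j => levelReach q [] (2 * n + 2 + j)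
  exact Finset.le_sup (f := fun j => levelReach q [] (2 * n + 2 + j)) (Finset.mem_range.2 (Nat.lt_succ_self _))

/-- **The stage lemma of the diagonalization against `BPP^Ã`**: for every `P^Ã` machine `M` with
bound `q` and coin polynomial `p`, at every large level `n` and for every background oracle there
are a double window `(R, Y)` and a verdict `β` such that `Q₁` (run on `R ⊕ Y`) is on the side of
`β` while the acceptance probability of `(M, q, p)` at `1ⁿ` against the patched oracle is not.
Proof: otherwise the mask-averaged probability `h(x) = 𝔼_R extAcc(…(R, R ⊕ x)…)` satisfies
`2·q1Accept(x) − 4/3 ≤ h(x) ≤ 2·q1Accept(x) + 1/3`, so `𝔼_{𝒟₁} h − 𝔼_U h ≥ 1/3 − 4/n² > 1/10` by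
Claim 8.1, contradicting `ext_gap_small`. [cite: BernsteinVazirani1997, Cor. 8.14] [cite: RazTalJACM2022, App. A] -/
theorem exists_defeating_dwindow (M : OracleAlg Bool) (q p : Polynomial ℕ) :
    ∃ n₀ : ℕ, ∀ n, n₀ ≤ n → ∀ A₀ : Language Bool, ∃ (RY : Window n × Window n) (β : Bool),
      (β = true → 2 / 3 ≤ q1Accept n (xorWin RY.1 RY.2) ∧
        extAcc M q p (mPatchLevel A₀ n RY) (List.replicate n true) < 2 / 3) ∧
      (β = false → q1Accept n (xorWin RY.1 RY.2) ≤ 1 / 3 ∧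
        1 / 3 < extAcc M q p (mPatchLevel A₀ n RY) (List.replicate n true)) := by
  obtain ⟨n₁, h81⟩ := razTal2022_claim81_holds
  obtain ⟨n₂, h82⟩ := ext_gap_small M q p
  refine ⟨max (max n₁ n₂) 5, fun n hn A₀ => ?_⟩
  have hn₁ : n₁ ≤ n := le_trans (le_trans (le_max_left _ _) (le_max_left _ _)) hn
  have hn₂ : n₂ ≤ n := le_trans (le_trans (le_max_right _ _) (le_max_left _ _)) hn
  have hn5 : (5 : ℝ) ≤ n := by exact_mod_cast (le_max_right _ _).trans hn
  set z : List Bool := List.replicate n true with hz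
  -- the acceptance probability as a function of the double window, and its mask average
  set f : Window n × Window n → ℝ := fun RY => extAcc M q p (mPatchLevel A₀ n RY) z with hf
  have hf0 : ∀ RY, 0 ≤ f RY := fun RY => extAcc_nonneg _ _ _ _ _
  have hf1 : ∀ RY, f RY ≤ 1 := fun RY => extAcc_le_one _ _ _ _ _
  set h : Window n → ℝ := maskAvg M q p A₀ n z with hh
  have hcardW : (0 : ℝ) < Fintype.card (Window n) := by exact_mod_cast Fintype.card_pos
  have hh_eq : ∀ x, h x = (∑ R : Window n, f (R, xorWin R x)) / Fintype.card (Window n) := fun x => rfl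
  by_contra H
  -- pointwise sandwich of `f`, hence of `h`, by the acceptance probability of `Q₁`
  have hlowf : ∀ RY : Window n × Window n, 2 * q1Accept n (xorWin RY.1 RY.2) - 4 / 3 ≤ f RY := by
    intro RY
    by_cases hx : 2 / 3 ≤ q1Accept n (xorWin RY.1 RY.2)
    · have h23 : 2 / 3 ≤ f RY :=
        not_lt.1 fun hlt => H ⟨RY, true, fun _ => ⟨hx, hlt⟩, fun h => Bool.noConfusion h⟩
      linarith [q1Accept_le_one n (xorWin RY.1 RY.2)]
    · linarith [hf0 RY]
  have hupf : ∀ RY : Window n × Window n, f RY ≤ 2 * q1Accept n (xorWin RY.1 RY.2) + 1 / 3 := by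
    intro RY
    by_cases hx : q1Accept n (xorWin RY.1 RY.2) ≤ 1 / 3
    · have h13 : f RY ≤ 1 / 3 :=
        not_lt.1 fun hlt => H ⟨RY, false, fun h => Bool.noConfusion h, fun _ => ⟨hx, hlt⟩⟩
      linarith [q1Accept_nonneg n (xorWin RY.1 RY.2)]
    · linarith [hf1 RY]
  have hlow : ∀ x : Window n, 2 * q1Accept n x - 4 / 3 ≤ h x := by
    intro x
    rw [hh_eq, le_div_iff₀ hcardW]
    calc (2 * q1Accept n x - 4 / 3) * Fintype.card (Window n) = ∑ _R : Window n, (2 * q1Accept n x - 4 / 3) := by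
          rw [sum_const, card_univ, nsmul_eq_mul, mul_comm]
      _ ≤ ∑ R : Window n, f (R, xorWin R x) := sum_le_sum fun R _ => by
          have := hlowf (R, xorWin R x)
          simp only [xorWin_xorWin_cancel] at this
          exact this
  have hup : ∀ x : Window n, h x ≤ 2 * q1Accept n x + 1 / 3 := by
    intro x
    rw [hh_eq, div_le_iff₀ hcardW]
    calc ∑ R : Window n, f (R, xorWin R x) ≤ ∑ _R : Window n, (2 * q1Accept n x + 1 / 3) :=
          sum_le_sum fun R _ => by
            have := hupf (R, xorWin R x)
            simp only [xorWin_xorWin_cancel] at this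
            exact this
      _ = (2 * q1Accept n x + 1 / 3) * Fintype.card (Window n) := by
          rw [sum_const, card_univ, nsmul_eq_mul, mul_comm]
  obtain ⟨hD, hU⟩ := h81 n hn₁
  -- expectation under `𝒟₁`
  have hED : 2 / 3 - 2 / (n : ℝ) ^ 2 ≤ ∑ x, rtD1 n x * h x := by
    have h1 : ∑ x, rtD1 n x * (2 * q1Accept n x - 4 / 3) ≤ ∑ x, rtD1 n x * h x :=
      Finset.sum_le_sum fun x _ => mul_le_mul_of_nonneg_left (hlow x) (rtD1_nonneg n x)
    have h2 : ∑ x, rtD1 n x * (2 * q1Accept n x - 4 / 3) = 2 * ∑ x, rtD1 n x * q1Accept n x - 4 / 3 := by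
      have h3 : ∀ x, rtD1 n x * (2 * q1Accept n x - 4 / 3) =
          2 * (rtD1 n x * q1Accept n x) - 4 / 3 * rtD1 n x := fun x => by ring
      simp_rw [h3]
      rw [Finset.sum_sub_distrib, ← Finset.mul_sum, ← Finset.mul_sum, sum_rtD1, mul_one]
    have h4 : 2 * (1 - 1 / (n : ℝ) ^ 2) - 4 / 3 = 2 / 3 - 2 / (n : ℝ) ^ 2 := by ring
    linarith
  -- expectation under the uniform distribution
  have hEU : (∑ x, h x) / Fintype.card (Window n) ≤ 2 / (n : ℝ) ^ 2 + 1 / 3 := by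
    have h1 : ∑ x, h x ≤ 2 * ∑ x, q1Accept n x + Fintype.card (Window n) * (1 / 3) := by
      calc ∑ x, h x ≤ ∑ x, (2 * q1Accept n x + 1 / 3) := Finset.sum_le_sum fun x _ => hup x
        _ = 2 * ∑ x, q1Accept n x + Fintype.card (Window n) * (1 / 3) := by
          rw [Finset.sum_add_distrib, ← Finset.mul_sum, Finset.sum_const, Finset.card_univ, nsmul_eq_mul]
    have h2 : (∑ x, h x) / Fintype.card (Window n) ≤ 2 * ((∑ x, q1Accept n x) / Fintype.card (Window n)) + 1 / 3 := by
      rw [div_le_iff₀ hcardW]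
      calc ∑ x, h x ≤ 2 * ∑ x, q1Accept n x + Fintype.card (Window n) * (1 / 3) := h1
        _ = (2 * ((∑ x, q1Accept n x) / Fintype.card (Window n)) + 1 / 3) * Fintype.card (Window n) := by
            field_simp
    have h4 : (2 : ℝ) / (n : ℝ) ^ 2 = 2 * (1 / (n : ℝ) ^ 2) := by ring
    rw [h4]
    linarith [mul_le_mul_of_nonneg_left hU (show (0 : ℝ) ≤ 2 by norm_num)]
  have h4n : 4 / (n : ℝ) ^ 2 ≤ 4 / 25 := by
    rw [div_le_div_iff₀ (by positivity) (by norm_num)]; nlinarith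
  have hgap := h82 n hn₂ A₀
  have := le_abs_self (∑ x, rtD1 n x * h x - (∑ x, h x) / Fintype.card (Window n))
  have h2n : (2 : ℝ) / (n : ℝ) ^ 2 + 2 / (n : ℝ) ^ 2 = 4 / (n : ℝ) ^ 2 := by ring
  linarith

/-- Default double windows: mask `0` and a window accepted by `Q₁` with probability `≥ 2/3`
(from Claim 8.1, as `exists_good_window`). [cite: RazTalJACM2022, Claim 8.1] -/
theorem exists_good_dwindow {n₁ : ℕ}
    (h81 : ∀ n : ℕ, n₁ ≤ n →
      1 - 1 / (n : ℝ) ^ 2 ≤ ∑ x : Window n, rtD1 n x * q1Accept n x ∧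
        (∑ x : Window n, q1Accept n x) / Fintype.card (Window n) ≤ 1 / (n : ℝ) ^ 2)
    (n : ℕ) : ∃ RY : Window n × Window n, max n₁ 2 ≤ n → 2 / 3 ≤ q1Accept n (xorWin RY.1 RY.2) := by
  obtain ⟨w, hw⟩ := exists_good_window h81 n
  refine ⟨(fun _ _ => false, w), fun h => ?_⟩
  have hx : xorWin (fun _ _ => false) w = w := by funext i k; simp [xorWin]
  rw [hx]
  exact hw h

/-! ### Assembly -/

/-- **Aaronson–Wigderson, Thm. 5.11 (v): there is an oracle language `A` with `BQP^A ⊄ BPP^Ã`, `Ã`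
the multilinear extension of `A`** (AW, STOC 2008 full version, Thm. 5.11 (v) p. 28: "there exist
`A, Ã` such that … `BQP^A ⊄ BPP^Ã` … furthermore `Ã` is simply the multilinear extension of `A`";
AW sketch it from Raz's quantum/classical communication separation through the transfer principle
Thm. 4.11; here the separating problem is XOR-masked Forrelation, the transfer principle enters as
`isRectSimple_accept_multilinearExtension`, and the communication-side lower bound is the Fourier
growth of XOR-fibres fed into Raz–Tal's Thm. 7.4). The oracle is the limit of the stages
`mDiagSeq` run with the stage lemma `exists_defeating_dwindow`; the separating language is
`L = {x : |x| ≥ N₀, q1Accept |x| (R_{|x|} ⊕ Y_{|x|}) ≥ 2/3} ∈ BQP^A` by the masked machine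
`razTalMasked_bqpMachine`; a `BPP^Ã` machine `(M, q, p)` for `L` is defeated at the level of the
stage treating `⟨[p], M, q⟩`, where its acceptance probability at `1ⁿ` is on the wrong side of
the promise. [cite: AaronsonWigderson2008, Thm. 5.11 (v)] [cite: RazTalJACM2022, App. A] [cite: Ko1989, §3] -/
theorem exists_oracle_BQPRel_not_subset_BPPRel_multilinearExtension :
    ∃ A : Language Bool, ¬ BQPRel A ⊆ BPPRel (multilinearExtension A).toOracle := by
  classical
  -- enumeration of the descriptions and the choices of the stage lemma
  obtain ⟨e, he⟩ := exists_enum_PHDescr countable_polyTimeOracleAlg_holds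
  choose thr hthr using fun D : PHDescr => exists_defeating_dwindow D.M D.q (D.bounds.headD 0)
  have hthr' : ∀ (D : PHDescr) (n : ℕ) (A₀ : Language Bool), ∃ pr : (Window n × Window n) × Bool, thr D ≤ n →
      (pr.2 = true → 2 / 3 ≤ q1Accept n (xorWin pr.1.1 pr.1.2) ∧
        extAcc D.M D.q (D.bounds.headD 0) (mPatchLevel A₀ n pr.1) (List.replicate n true) < 2 / 3) ∧
      (pr.2 = false → q1Accept n (xorWin pr.1.1 pr.1.2) ≤ 1 / 3 ∧
        1 / 3 < extAcc D.M D.q (D.bounds.headD 0) (mPatchLevel A₀ n pr.1) (List.replicate n true)) := by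
    intro D n A₀
    by_cases hn : thr D ≤ n
    · obtain ⟨RY, β, h⟩ := hthr D n hn A₀
      exact ⟨(RY, β), fun _ => h⟩
    · exact ⟨((fun _ _ => false, fun _ _ => false), false), fun h => absurd h hn⟩
  choose pick hpick using hthr'
  -- default double windows and the first level
  obtain ⟨n₁, h81⟩ := razTal2022_claim81_holds
  choose W₀ hW₀ using exists_good_dwindow h81
  set N₀ : ℕ := max n₁ 2 with hN₀
  -- the oracle
  set W : DWindows := mDiagW W₀ N₀ thr pick e with hW
  refine ⟨mLangOf W, fun hsub => ?_⟩
  -- every level of the oracle respects the promise of `Q₁`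
  have hprom : ∀ n, N₀ ≤ n → 2 / 3 ≤ q1Accept n (xorWin (W n).1 (W n).2) ∨
      q1Accept n (xorWin (W n).1 (W n).2) ≤ 1 / 3 := by
    intro n hn
    rcases mDiagW_eq_or W₀ N₀ thr pick e n with h | ⟨i, rfl⟩
    · left; rw [hW, h]; exact hW₀ n hn
    · have hp := hpick (e i) (mStageLvl W₀ N₀ thr pick e i) (mLangOf (mDiagSeq W₀ N₀ thr pick e i).W)
        (thr_le_mStageLvl W₀ N₀ thr pick e i)
      rw [hW, mDiagW_mStageLvl]
      obtain ⟨ht, hf⟩ := hp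
      cases hβ : (mStagePick W₀ N₀ thr pick e i).2
      · exact Or.inr (hf hβ).1
      · exact Or.inl (ht hβ).1
  -- the `BQP^A` machine and the separating language
  obtain ⟨F, hFu, hF⟩ := razTalMasked_bqpMachine N₀ fun _ => false
  set L : Language Bool := {x | N₀ ≤ x.length ∧ 2 / 3 ≤ q1Accept x.length (xorWin (W x.length).1 (W x.length).2)} with hL
  have hLBQP : L ∈ BQPRel (mLangOf W) := by
    refine ⟨F, hFu, fun x => ⟨fun hx => ?_, fun hx => ?_⟩⟩
    · obtain ⟨hxn, hxq⟩ := hx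
      rw [(hF (mLangOf W) x).2 hxn, mWindow_mLangOf]
      exact hxq
    · by_cases hxn : N₀ ≤ x.length
      · rw [(hF (mLangOf W) x).2 hxn, mWindow_mLangOf]
        have hxq : ¬ 2 / 3 ≤ q1Accept x.length (xorWin (W x.length).1 (W x.length).2) := fun h => hx ⟨hxn, h⟩
        rcases hprom x.length hxn with h | h
        · exact absurd h hxq
        · exact h
      · rw [(hF (mLangOf W) x).1 (lt_of_not_ge hxn)]
        norm_num
  -- a `BPP^Ã` machine for `L`
  obtain ⟨L', hL'P, p, hp⟩ := hsub hLBQP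
  obtain ⟨M, hM, q, hq⟩ := hL'P
  have hbase : extBase M q (mLangOf W) = L' := extBase_eq_of_PRel hq
  -- its description is some `e i`; stage `i` defeated it
  obtain ⟨i, hi⟩ := he (show (⟨[p], M, q⟩ : PHDescr) ∈ {D : PHDescr | D.M.IsPolyTime encodingBoolBool} from hM)
  have hpk := hpick (e i) (mStageLvl W₀ N₀ thr pick e i) (mLangOf (mDiagSeq W₀ N₀ thr pick e i).W)
    (thr_le_mStageLvl W₀ N₀ thr pick e i)
  have heM : (e i).M = M := by rw [hi]
  have heq : (e i).q = q := by rw [hi]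
  have hep : (e i).bounds.headD 0 = p := by rw [hi]; rfl
  simp only [heM, heq, hep] at hpk
  obtain ⟨ht, hf⟩ := hpk
  set n := mStageLvl W₀ N₀ thr pick e i with hn
  have hsp : pick (e i) n (mLangOf (mDiagSeq W₀ N₀ thr pick e i).W) = mStagePick W₀ N₀ thr pick e i := rfl
  rw [hsp] at ht hf
  have hWn : W n = (mStagePick W₀ N₀ thr pick e i).1 := by rw [hW]; exact mDiagW_mStageLvl W₀ N₀ thr pick e i
  have hN₀n : N₀ ≤ n :=
    le_trans (le_trans (Nat.le_add_right N₀ i) (add_le_mlvl W₀ N₀ thr pick e i)) (lvl_le_mStageLvl W₀ N₀ thr pick e i)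
  -- the acceptance probability at `1ⁿ` is the same for the stage-`i+1` oracle and for the limit
  have hpatch : mPatchLevel (mLangOf (mDiagSeq W₀ N₀ thr pick e i).W) n (mStagePick W₀ N₀ thr pick e i).1 =
      mLangOf (mDiagSeq W₀ N₀ thr pick e (i + 1)).W := by
    rw [mPatchLevel_mLangOf, mDiagSeq_succ_W]
  have hloc : extAcc M q p (mLangOf W) (List.replicate n true) =
      extAcc M q p (mLangOf (mDiagSeq W₀ N₀ thr pick e (i + 1)).W) (List.replicate n true) := by
    refine extAcc_congr M q p (List.replicate n true) fun s hs => ?_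
    rw [List.length_replicate] at hs
    rw [hW]
    refine mem_mLangOf_mDiagW_iff W₀ N₀ thr pick e i s ?_
    rw [hi]
    exact hs.trans (extReach_le_reach M q p n)
  -- membership of `1ⁿ` in `L`
  have hmemL : List.replicate n true ∈ L ↔ 2 / 3 ≤ q1Accept n (xorWin (W n).1 (W n).2) := by
    have hlen : (List.replicate n true).length = n := by simp
    change (N₀ ≤ (List.replicate n true).length ∧
      2 / 3 ≤ q1Accept (List.replicate n true).length
        (xorWin (W (List.replicate n true).length).1 (W (List.replicate n true).length).2)) ↔ _
    rw [hlen]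
    exact ⟨fun h => h.2, fun h => ⟨hN₀n, h⟩⟩
  have hprob := hp (List.replicate n true)
  rw [List.length_replicate] at hprob
  have hacc_eq : uniformProb (p.eval n) {r | boolPair (List.replicate n true) r ∈ extBase M q (mLangOf W)} =
      extAcc M q p (mLangOf W) (List.replicate n true) := by
    simp [extAcc]
  cases hβ : (mStagePick W₀ N₀ thr pick e i).2
  · -- verdict `false`
    obtain ⟨hq1, hacc⟩ := hf hβ
    have hnot : List.replicate n true ∉ L := fun h => by
      have h' := hmemL.1 h
      rw [hWn] at h'
      linarith
    have hset : {y : List Bool | boolPair (List.replicate n true) y ∈ L' ↔ List.replicate n true ∈ L} =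
        {y : List Bool | boolPair (List.replicate n true) y ∈ extBase M q (mLangOf W)}ᶜ := by
      ext y
      simp only [Set.mem_setOf_eq, Set.mem_compl_iff, hbase, iff_false_right hnot]
    rw [hset, uniformProb_compl, hacc_eq, hloc, ← hpatch] at hprob
    linarith
  · -- verdict `true`
    obtain ⟨hq1, hacc⟩ := ht hβ
    have hmem : List.replicate n true ∈ L := by
      refine hmemL.2 ?_
      rw [hWn]
      exact hq1
    have hset : {y : List Bool | boolPair (List.replicate n true) y ∈ L' ↔ List.replicate n true ∈ L} =
        {y : List Bool | boolPair (List.replicate n true) y ∈ extBase M q (mLangOf W)} := by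
      ext y
      simp only [Set.mem_setOf_eq, hbase, iff_true_right hmem]
    rw [hset, hacc_eq, hloc, ← hpatch] at hprob
    linarith

end Literature.Computability.QuantumComplexity

end
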